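import Literature.Geometry.Symplectic.SphereIntersectionIndexHomological
import Literature.Geometry.Symplectic.JCurveIntersectionCountHomologicalProofs
import Literature.AlgebraicTopology.SingularHomology.ZeroSetFunctional
import Literature.AlgebraicTopology.SingularHomology.LocalDegreeWindingNumber
import Literature.AlgebraicTopology.SingularHomology.PositiveAtlasOrientation
import Literature.AlgebraicTopology.SingularHomology.FundamentalClassExistence
import Literature.Topology.FourManifolds.ComplexProjectiveSpacePositiveAtlas
import HarnessLib

/-!
# Proof of `sphere_zeroSetIndex_factorsThroughHomology`

Sibling proof file of `SphereIntersectionIndexHomological.lean` (D-0014): it discharges the named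
fact `Literature.Geometry.Symplectic.sphere_zeroSetIndex_factorsThroughHomology` — the sum of the
winding-number indices of a smooth two-chart sphere against a compact co-oriented surface
`K = {π = 0}` in a 4-manifold is the value of an additive functional on `H₂(X; ℤ)` at the class of
the sphere (G. E. Bredon, *Topology and Geometry* (1993), VI.11: Def. 11.1 (Thom class), Thm. 11.9
and p. 375 (intersection numbers are sums of local intersection numbers); IV.7 Cor. 7.5 and the
Example following it (local degrees; `deg zᵏ = k`)).

## The argument (homological form, no Poincaré duality needed)

* The functional is `Λ : H₂(X) → H₂(X | K) ≅ H₂(U | K) → H₂(ℂ | 0)` (localisation at the compact,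
  hence closed, `K`; excision into the open `U`; push-forward along `π`), read in `ℤ` through a
  generator `b₀` of `H₂(ℂ | 0) ≅ ℤ` (`…ZeroSetFunctional`);
* for the glued sphere `F : ℂℙ¹ → X` the class `F⁎[ℂℙ¹]` localises at the finitely many crossings,
  and `Λ(F⁎[ℂℙ¹])` is the sum of the local values (`map_eq_sum_smul_of_crossings`, Milnor's
  diagram for Lemma 6.3 / Bredon VI.11);
* at a crossing read in an affine chart of `ℂℙ¹` the local value is the local degree of
  `π ∘ u : ℂ → ℂ` at an isolated zero, which is the winding number of `π ∘ u` on small circles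
  (`localDegree_eq_wind_smul_localClass`, Bredon IV.7);
* the fundamental class of `ℂℙ¹` localises to the chart-transported generators up to ONE global
  sign (the affine atlas of `ℂℙ¹` is positive, `ComplexProjectiveSpace.isPositiveAtlas` of
  `…ComplexProjectiveSpacePositiveAtlas`, so it carries the orientation `positiveAtlasOrientation`,
  and `ℂℙ¹` is connected, so its chosen orientation `homologicalOrientationInt 1` is `±` that one);
  the sign is absorbed into the functional.

The affine charts are read in `ℂ` through a real-linear identification
`ι : ℂ ≃L[ℝ] ℝ²` with `affineChart i p = ι (affineCoordComplex i p 0)` (hypothesis `hι` of the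
lemmas; the identification `z ↦ realCoordinates 1 (fun _ => z)` of `…ComplexProjectiveSpacePositiveAtlas`
qualifies, `affineChart_eq_iota`).

Everything here is proved; no definitions, no named facts.

## References

* G. E. Bredon, *Topology and Geometry*, GTM 139, Springer (1993), VI.11 (Def. 11.1, Thm. 11.9,
  p. 375) and IV.7 (Cor. 7.5 and Example). [Bredon1993]
* V. Guillemin, A. Pollack, *Differential Topology* (1974), Ch. 3 §3. [GuilleminPollack1974]
* A. Hatcher, *Algebraic Topology*, CUP (2002), Thm. 2.20, §3.3. [HatcherAT2002]
-/

noncomputable section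

open scoped Manifold ContDiff Topology
open CategoryTheory Set Function Metric Complex
open Literature.Topology.FourManifolds Literature.Topology.FourManifolds.ComplexProjectiveSpace
  Literature.AlgebraicTopology.SingularHomology Literature.Topology.PlaneTopology

namespace Literature.Geometry.Symplectic

namespace SphereZeroSetIndex

/-! ### The affine charts of `ℂℙ¹` read in `ℂ` through `ι` -/

/-- **The bundled identification `ℂ ≃ ℂ¹ ≃ ℝ²` of the affine charts of `ℂℙ¹`**: for
`ι = (funUnique)⁻¹ ≫ realCoordinates 1` one has `affineChart i p = ι (affineCoordComplex i p 0)`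
(`ComplexProjectiveSpace.affineChart_apply_eq`). [folklore] -/
theorem affineChart_eq_iota (i : Fin (1 + 1)) (p : ComplexProjectiveSpace 1) :
    affineChart i p = ((ContinuousLinearEquiv.funUnique (Fin 1) ℝ ℂ).symm.trans (realCoordinates 1))
      (affineCoordComplex i p 0) := by
  rw [ComplexProjectiveSpace.affineChart_apply_eq, ContinuousLinearEquiv.trans_apply]
  congr 1

/-- The point of the `i`-th chart with complex coordinate `z` has coordinate `z`. [folklore] -/
theorem affineCoordComplex_symm_iota (ι : ℂ ≃L[ℝ] (EuclideanSpace ℝ (Fin (2 * 1))))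
    (hι : ∀ (i : Fin (1 + 1)) (p : ComplexProjectiveSpace 1), affineChart i p = ι (affineCoordComplex i p 0))
    (i : Fin (1 + 1)) (z : ℂ) :
    affineCoordComplex i ((affineChart i).symm (ι z)) 0 = z := by
  have h := (affineChart i).right_inv (mem_univ (ι z) : ι z ∈ (affineChart (n := 1) i).target)
  rw [hι] at h
  exact ι.injective h

/-- A point of the `i`-th chart domain is the chart point of its coordinate. [folklore] -/
theorem eq_symm_iota_of_coordNeZero (ι : ℂ ≃L[ℝ] (EuclideanSpace ℝ (Fin (2 * 1))))
    (hι : ∀ (i : Fin (1 + 1)) (p : ComplexProjectiveSpace 1), affineChart i p = ι (affineCoordComplex i p 0))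
    {i : Fin (1 + 1)} {p : ComplexProjectiveSpace 1} (hp : CoordNeZero i p) :
    p = (affineChart i).symm (ι (affineCoordComplex i p 0)) := by
  rw [← hι]
  exact ((affineChart i).left_inv hp).symm

/-- Every point of `ℂℙ¹` is in the chart-`0` domain or is the point `∞ = [0 : 1]` of chart `1`
with coordinate `0`. [folklore] -/
theorem coordNeZero_zero_or_eq_infty (ι : ℂ ≃L[ℝ] (EuclideanSpace ℝ (Fin (2 * 1))))
    (hι : ∀ (i : Fin (1 + 1)) (p : ComplexProjectiveSpace 1), affineChart i p = ι (affineCoordComplex i p 0))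
    (p : ComplexProjectiveSpace 1) :
    CoordNeZero 0 p ∨ p = (affineChart 1).symm (ι 0) := by
  by_cases h0 : CoordNeZero 0 p
  · exact Or.inl h0
  · right
    rw [eq_symm_iota_of_coordNeZero ι hι (coordNeZero_one_of_not_coordNeZero_zero h0),
      affineCoordComplex_one_eq_zero h0]

/-- The point `∞ = [0 : 1]` is not in the chart-`0` domain. [folklore] -/
theorem not_coordNeZero_zero_infty (ι : ℂ ≃L[ℝ] (EuclideanSpace ℝ (Fin (2 * 1))))
    (hι : ∀ (i : Fin (1 + 1)) (p : ComplexProjectiveSpace 1), affineChart i p = ι (affineCoordComplex i p 0)) :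
    ¬ CoordNeZero 0 ((affineChart 1).symm (ι 0) : ComplexProjectiveSpace 1) := by
  intro h0
  have h1 := coordNeZero_affineChart_symm (n := 1) 1 (ι 0)
  have hne := affineCoordComplex_zero_ne_zero h0 h1
  have e := affineCoordComplex_one_eq_inv ((affineChart 1).symm (ι 0) : ComplexProjectiveSpace 1)
  rw [affineCoordComplex_symm_iota ι hι] at e
  exact inv_ne_zero hne e.symm

/-! ### One crossing read in an affine chart -/

/-- `ι⁻¹` is a map of pairs `(ℝ², ℝ² ∖ ι 0) → (ℂ, ℂ ∖ 0)`. [folklore] -/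
theorem mapsTo_iota_symm (ι : ℂ ≃L[ℝ] (EuclideanSpace ℝ (Fin (2 * 1)))) :
    MapsTo ι.symm.toHomeomorph ({ι 0}ᶜ : Set (EuclideanSpace ℝ (Fin (2 * 1)))) ({0}ᶜ : Set ℂ) := by
  intro x hx h0
  apply hx
  rw [mem_singleton_iff] at h0 ⊢
  have h1 : ι.symm x = 0 := by simpa using h0
  rw [← ι.apply_symm_apply x, h1]

/-- …and `ι` is a map of pairs `(ℂ, ℂ ∖ 0) → (ℝ², ℝ² ∖ ι 0)`. [folklore] -/
theorem mapsTo_iota_symm_symm (ι : ℂ ≃L[ℝ] (EuclideanSpace ℝ (Fin (2 * 1)))) :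
    MapsTo ι.symm.toHomeomorph.symm ({0}ᶜ : Set ℂ) ({ι 0}ᶜ : Set (EuclideanSpace ℝ (Fin (2 * 1)))) := by
  intro z hz h0
  apply hz
  rw [mem_singleton_iff] at h0 ⊢
  have h1 : ι z = ι 0 := by simpa using h0
  exact ι.injective h1

/-- **The local value at one crossing read in a chart of `ℂℙ¹`** (Bredon 1993, IV.7 Cor. 7.5
and Example; VI.11 p. 375).  Let `κ : X → ℂ` be continuous on `N`, `F : ℂℙ¹ → X`, and
`c' = c|W` an open restriction of a chart `c` of `ℂℙ¹` with `F(c'.source) ⊆ N`; let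
`r ∈ c'.target` be such that `κ ∘ F ≠ 0` on `c'.source` off the point `c'⁻¹ r`, and let the closed
disc of radius `ρ > 0` about `r` (read in `ℂ` through `ι`) lie in `c'.target`.  Then pushing the
chart-transported generator `(c'⁻¹)⁎ g_r ∈ H₂(c'.source | c'⁻¹ r)` forward along `κ ∘ F` gives
`w • b₀`, where `w` is the winding number of `κ ∘ F ∘ c⁻¹ ∘ ι` on the circle of radius `ρ` about
`ι⁻¹ r` and `b₀ = (ι⁻¹)⁎ g_{ι 0} ∈ H₂(ℂ | 0)` (`localDegree_eq_wind_smul_localClass` transported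
along the chart by `relativeSingularHomology.xEquiv_map`).
[cite: Bredon1993, IV.7 Cor. 7.5 and Example; VI.11 p. 375] -/
theorem map_chartClass_eq_wind_smul (g : HomologicalOrientation ℤ (EuclideanSpace ℝ (Fin (2 * 1))) (2 * 1))
    (ι : ℂ ≃L[ℝ] (EuclideanSpace ℝ (Fin (2 * 1))))
    {X : Type} [TopologicalSpace X] {N : Set X} (κ : X → ℂ) (hκ : ContinuousOn κ N)
    (F : C(ComplexProjectiveSpace 1, X)) (c : OpenPartialHomeomorph (ComplexProjectiveSpace 1) (EuclideanSpace ℝ (Fin (2 * 1))))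
    {W : Set (ComplexProjectiveSpace 1)} (hW : IsOpen W)
    (hWN : ∀ t ∈ (c.restrOpen W hW).source, F t ∈ N) (r : ↥(c.restrOpen W hW).target)
    (hKφ : MapsTo (fun t : ↥(c.restrOpen W hW).source => κ (F t))
      ({(c.restrOpen W hW).toHomeomorphSourceTarget.symm r}ᶜ) ({0}ᶜ : Set ℂ))
    {ρ : ℝ} (hρ : 0 < ρ)
    (hρW : ι '' closedBall (ι.symm r) ρ ⊆ (c.restrOpen W hW).target) :
    relativeSingularHomology.map ℤ ℤ
        (⟨fun t : ↥(c.restrOpen W hW).source => κ (F t),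
          hκ.comp_continuous (F.continuous.comp continuous_subtype_val) fun t => hWN t t.2⟩ :
          C(↥(c.restrOpen W hW).source, ℂ)) hKφ (2 * 1)
        (localHomology.xEquiv ℤ ℤ (c.restrOpen W hW).toHomeomorphSourceTarget.symm r (2 * 1)
          ((localHomology.openSubsetIso ℤ ℤ (c.restrOpen W hW).open_target r.2 (2 * 1)).inv
            (g.localClass (r : (EuclideanSpace ℝ (Fin (2 * 1))))))) =
      wind (fun s => κ (F (c.symm (ι (circleLoop (ι.symm r) ρ s))))) •
        relativeSingularHomology.xEquiv ℤ ℤ ι.symm.toHomeomorph (mapsTo_iota_symm ι)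
          (mapsTo_iota_symm_symm ι) (2 * 1) (g.localClass (ι 0)) := by
  have hVo : IsOpen (c.restrOpen W hW).target := (c.restrOpen W hW).open_target
  -- the map read in the chart
  have hκF : ContinuousOn (fun y => κ (F (c.symm y))) (c.restrOpen W hW).target :=
    hκ.comp (F.continuous.comp_continuousOn (c.restrOpen W hW).continuousOn_symm)
      fun y hy => hWN _ ((c.restrOpen W hW).map_target hy)
  have htc : ContinuousOn (fun y => ι (κ (F (c.symm y)))) (c.restrOpen W hW).target :=
    ι.continuous.comp_continuousOn hκF
  have hmaps : MapsTo (fun y : ↥(c.restrOpen W hW).target => ι (κ (F (c.symm y))))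
      ({(⟨(r : (EuclideanSpace ℝ (Fin (2 * 1)))), r.2⟩ : ↥(c.restrOpen W hW).target)}ᶜ : Set ↥(c.restrOpen W hW).target)
      ({ι 0}ᶜ : Set (EuclideanSpace ℝ (Fin (2 * 1)))) := by
    intro y hy h0
    have hy' : (c.restrOpen W hW).toHomeomorphSourceTarget.symm y ∈
        ({(c.restrOpen W hW).toHomeomorphSourceTarget.symm r}ᶜ : Set ↥(c.restrOpen W hW).source) :=
      fun h' => hy (mem_singleton_iff.2
        ((c.restrOpen W hW).toHomeomorphSourceTarget.symm.injective (mem_singleton_iff.1 h')))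
    have h1 := hKφ hy'
    apply h1
    rw [mem_singleton_iff] at h0 ⊢
    change κ (F (c.symm y)) = 0
    exact ι.injective (by simpa using h0)
  -- the local degree theorem in the plane
  have hA := localDegree_eq_wind_smul_localClass g ι
    (fun y => ι (κ (F (c.symm y)))) hVo r.2 htc hmaps hρ hρW
  have hwind : wind (fun s => ι.symm ((fun y => ι (κ (F (c.symm y))))
      (ι (circleLoop (ι.symm r) ρ s))) -
        ι.symm (ι 0)) =
      wind (fun s => κ (F (c.symm (ι (circleLoop (ι.symm r) ρ s))))) := by
    congr 1
    funext s
    simp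
  -- transport along the chart (across universes)
  have hfg : ∀ y : ↥(c.restrOpen W hW).target,
      (⟨fun t : ↥(c.restrOpen W hW).source => κ (F t),
          hκ.comp_continuous (F.continuous.comp continuous_subtype_val) fun t => hWN t t.2⟩ :
          C(↥(c.restrOpen W hW).source, ℂ)) ((c.restrOpen W hW).toHomeomorphSourceTarget.symm y) =
        ι.symm.toHomeomorph
          ((⟨fun y : ↥(c.restrOpen W hW).target => ι (κ (F (c.symm y))),
            htc.restrict⟩ : C(↥(c.restrOpen W hW).target, (EuclideanSpace ℝ (Fin (2 * 1))))) y) := by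
    intro y
    change κ (F ((c.restrOpen W hW).symm y)) =
      ι.symm (ι (κ (F (c.symm y))))
    rw [ContinuousLinearEquiv.symm_apply_apply]
    rfl
  have key := relativeSingularHomology.xEquiv_map ℤ ℤ (c.restrOpen W hW).toHomeomorphSourceTarget.symm
    ι.symm.toHomeomorph _ _ hfg
    (mapsTo_compl_singleton (c.restrOpen W hW).toHomeomorphSourceTarget.symm.toEquiv r)
    (mapsTo_symm_compl_singleton (c.restrOpen W hW).toHomeomorphSourceTarget.symm.toEquiv r)
    (mapsTo_iota_symm ι) (mapsTo_iota_symm_symm ι) hmaps hKφ (2 * 1)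
    ((localHomology.openSubsetIso ℤ ℤ (c.restrOpen W hW).open_target r.2 (2 * 1)).inv
      (g.localClass (r : (EuclideanSpace ℝ (Fin (2 * 1))))))
  have hA' : relativeSingularHomology.map ℤ ℤ
      (⟨fun y : ↥(c.restrOpen W hW).target => ι (κ (F (c.symm y))), htc.restrict⟩ :
        C(↥(c.restrOpen W hW).target, (EuclideanSpace ℝ (Fin (2 * 1))))) hmaps (2 * 1)
      ((localHomology.openSubsetIso ℤ ℤ (c.restrOpen W hW).open_target r.2 (2 * 1)).inv
        (g.localClass (r : (EuclideanSpace ℝ (Fin (2 * 1)))))) =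
      wind (fun s => ι.symm ((fun y => ι (κ (F (c.symm y))))
        (ι (circleLoop (ι.symm r) ρ s))) -
          ι.symm (ι 0)) • g.localClass (ι 0) := hA
  change relativeSingularHomology.map ℤ ℤ _ hKφ (2 * 1)
    (relativeSingularHomology.xEquiv ℤ ℤ (c.restrOpen W hW).toHomeomorphSourceTarget.symm
      (mapsTo_compl_singleton (c.restrOpen W hW).toHomeomorphSourceTarget.symm.toEquiv r)
      (mapsTo_symm_compl_singleton (c.restrOpen W hW).toHomeomorphSourceTarget.symm.toEquiv r) (2 * 1)
      ((localHomology.openSubsetIso ℤ ℤ (c.restrOpen W hW).open_target r.2 (2 * 1)).inv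
        (g.localClass (r : (EuclideanSpace ℝ (Fin (2 * 1))))))) = _
  rw [← key, hA', map_zsmul, hwind]

/-! ### Small radii -/

/-- Finitely many positive reals have a common positive strict lower bound. [folklore] -/
theorem exists_pos_lt_forall {ι : Type*} [Fintype ι] (f : ι → ℝ) (hf : ∀ i, 0 < f i) :
    ∃ r₀ : ℝ, 0 < r₀ ∧ ∀ i, r₀ < f i := by
  classical
  rcases (Finset.univ : Finset ι).eq_empty_or_nonempty with h | h
  · refine ⟨1, one_pos, fun i => ?_⟩
    exact absurd (Finset.mem_univ i) (by rw [h]; exact Finset.notMem_empty i)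
  · obtain ⟨i₀, -, hmin⟩ := Finset.exists_min_image Finset.univ f h
    exact ⟨f i₀ / 2, by linarith [hf i₀], fun i => by linarith [hf i₀, hmin i (Finset.mem_univ i)]⟩

/-! ### The discharge -/

/-- **The intersection indices of smooth spheres with a compact co-oriented surface `K = {π = 0}`
add up to a homological invariant**: discharge of
`Literature.Geometry.Symplectic.sphere_zeroSetIndex_factorsThroughHomology` (Bredon 1993, VI.11
Def. 11.1, Thm. 11.9 and p. 375; IV.7 Cor. 7.5 and Example).  The functional is
`± (H₂(X) → H₂(X | K) ≅ H₂(U | K) → H₂(ℂ | 0) ≅ ℤ)`; its value on the glued sphere is the sum over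
the crossings of the local degrees of `π ∘ u` (resp. `π ∘ v`), i.e. of the winding numbers on small
circles. [cite: Bredon1993, VI.11 Thm. 11.9 and p. 375; IV.7 Cor. 7.5] -/
theorem _root_.Literature.Geometry.Symplectic.sphere_zeroSetIndex_factorsThroughHomology_holds :
    sphere_zeroSetIndex_factorsThroughHomology := by
  intro X _ _ _ _ _ _ JX π U hU hπ _ hKc
  classical
  -- the zero set `P`, the normal coordinate `K♯ = π|U`
  set P : Set X := {y : X | y ∈ U ∧ π y = 0} with hPdef
  have hPc : IsClosed P := hKc.isClosed
  have hPU : P ⊆ U := fun y hy => hy.1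
  have hπc : ContinuousOn π U := hπ.continuousOn
  let Kn : C(↥U, ℂ) := ⟨fun y => π y, hπc.restrict⟩
  have hK : MapsTo Kn (Subtype.val ⁻¹' Pᶜ) ({0}ᶜ : Set ℂ) := fun y hy h0 => hy ⟨y.2, h0⟩
  -- orientations: `g` of the model plane, `μ₀` of `ℂℙ¹` (positive atlas), the generator `b₀`
  obtain ⟨g₂⟩ := nonempty_homologicalOrientation_euclidean 2
  let g : HomologicalOrientation ℤ (EuclideanSpace ℝ (Fin (2 * 1))) (2 * 1) := g₂
  have hXpos : IsPositiveAtlas (2 * 1) (ComplexProjectiveSpace 1) := ComplexProjectiveSpace.isPositiveAtlas 1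
  -- the identification `ι : ℂ ≃ ℝ²` of the affine charts
  set ι : ℂ ≃L[ℝ] (EuclideanSpace ℝ (Fin (2 * 1))) :=
    (ContinuousLinearEquiv.funUnique (Fin 1) ℝ ℂ).symm.trans (realCoordinates 1) with hιdef
  have hι : ∀ (i : Fin (1 + 1)) (p : ComplexProjectiveSpace 1), affineChart i p = ι (affineCoordComplex i p 0) :=
    affineChart_eq_iota
  let μ₀ : HomologicalOrientation ℤ (ComplexProjectiveSpace 1) (2 * 1) := positiveAtlasOrientation hXpos g
  let b₀ : relativeSingularHomology ℤ ℤ ℂ ({0}ᶜ : Set ℂ) (2 * 1) :=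
    relativeSingularHomology.xEquiv ℤ ℤ ι.symm.toHomeomorph (mapsTo_iota_symm ι)
      (mapsTo_iota_symm_symm ι) (2 * 1) (g.localClass (ι 0))
  obtain ⟨eg, heg⟩ := g.isGenerator (ι 0)
  let eb : relativeSingularHomology ℤ ℤ ℂ ({0}ᶜ : Set ℂ) (2 * 1) ≃ₗ[ℤ] ℤ :=
    (relativeSingularHomology.xEquiv ℤ ℤ ι.symm.toHomeomorph (mapsTo_iota_symm ι)
      (mapsTo_iota_symm_symm ι) (2 * 1)).symm.trans eg
  have heb : eb b₀ = 1 := by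
    simp only [eb, b₀, LinearEquiv.trans_apply, LinearEquiv.symm_apply_apply]
    exact heg
  -- the functional `Λ : H₂(X) → H₂(X | P) ≅ H₂(U | P) → H₂(ℂ | 0)` and `cΛ = eb ∘ Λ`
  haveI := isIso_map_subsetIncl_of_isClosed_subset hPc hU hPU (2 * 1)
  let exc := relativeSingularHomology.map ℤ ℤ (subsetIncl U) (mapsTo_preimage Subtype.val Pᶜ) (2 * 1)
  let Λ : singularHomology ℤ ℤ X (2 * 1) ⟶ relativeSingularHomology ℤ ℤ ℂ ({0}ᶜ : Set ℂ) (2 * 1) :=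
    singularHomology.toLocalOfSet ℤ ℤ X P (2 * 1) ≫ inv exc ≫ relativeSingularHomology.map ℤ ℤ Kn hK (2 * 1)
  let cΛ : singularHomology ℤ ℤ X (2 * 1) →+ ℤ := eb.toAddMonoidHom.comp Λ.hom.toAddMonoidHom
  have hcΛ : ∀ x, cΛ x = eb (relativeSingularHomology.map ℤ ℤ Kn hK (2 * 1)
      (inv exc (singularHomology.toLocalOfSet ℤ ℤ X P (2 * 1) x))) := fun x => rfl
  -- CORE: the value on a glued sphere, for the positive-atlas orientation `μ₀`
  have core : ∀ (u v : ℂ → X) (F : C(ComplexProjectiveSpace 1, X)),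
      ContMDiff 𝓘(ℝ, ℂ) (𝓡 4) ∞ u → ContMDiff 𝓘(ℝ, ℂ) (𝓡 4) ∞ v → (∀ z : ℂ, z ≠ 0 → v z = u z⁻¹) →
      (∀ p, CoordNeZero 0 p → F p = u (affineCoordComplex 0 p 0)) →
      (∀ p, CoordNeZero 1 p → F p = v (affineCoordComplex 1 p 0)) →
      {z : ℂ | u z ∈ U ∧ π (u z) = 0}.Finite →
      ∃ r₀ : ℝ, 0 < r₀ ∧ ∀ r : ℝ, 0 < r → r ≤ r₀ →
        cΛ (singularHomology.map ℤ ℤ F (2 * 1) μ₀.fundamentalClass) =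
          (∑ᶠ z ∈ {z : ℂ | u z ∈ U ∧ π (u z) = 0}, wind (fun t => π (u (circleLoop z r t)))) +
          (∑ᶠ w ∈ {w : ℂ | w = 0 ∧ v w ∈ U ∧ π (v w) = 0}, wind (fun t => π (v (circleLoop w r t)))) := by
    intro u v F hu hv huv hF0 hF1 hfin
    have huc : Continuous u := hu.continuous
    have hvc : Continuous v := hv.continuous
    set Z : Set ℂ := {z : ℂ | u z ∈ U ∧ π (u z) = 0} with hZ
    set Zi : Set ℂ := {w : ℂ | w = 0 ∧ v w ∈ U ∧ π (v w) = 0} with hZi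
    have hZi_fin : Zi.Finite := (Set.finite_singleton (0 : ℂ)).subset fun w hw => hw.1
    haveI : Fintype ↥Z := hfin.fintype
    haveI : Fintype ↥Zi := hZi_fin.fintype
    -- radii for the chart-`0` crossings
    have hZopen : IsOpen (u ⁻¹' U) := hU.preimage huc
    have hδ : ∀ z : ↥Z, ∃ δ > 0, ball (z : ℂ) δ ⊆ u ⁻¹' U ∧ ∀ z' ∈ Z, z' ∈ ball (z : ℂ) δ → z' = z := by
      intro z
      obtain ⟨δ₁, hδ₁, hb₁⟩ := Metric.isOpen_iff.1 hZopen z z.2.1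
      have hopen : IsOpen (Z \ {(z : ℂ)})ᶜ := (hfin.subset Set.sdiff_subset).isClosed.isOpen_compl
      obtain ⟨δ₂, hδ₂, hb₂⟩ := Metric.isOpen_iff.1 hopen z fun h => h.2 rfl
      refine ⟨min δ₁ δ₂, lt_min hδ₁ hδ₂, (ball_subset_ball (min_le_left _ _)).trans hb₁,
        fun z' hz' hb => ?_⟩
      by_contra hne
      exact hb₂ (ball_subset_ball (min_le_right _ _) hb) ⟨hz', hne⟩
    choose δ hδpos hδU hδsep using hδ
    -- radius for the chart-`1` crossing
    have hδi : ∃ δ' > 0, (v 0 ∈ U → ball (0 : ℂ) δ' ⊆ v ⁻¹' U) ∧ ∀ z ∈ Z, δ' * ‖z‖ < 1 := by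
      obtain ⟨δa, hδa, hba⟩ : ∃ δa > 0, v 0 ∈ U → ball (0 : ℂ) δa ⊆ v ⁻¹' U := by
        by_cases h0 : v 0 ∈ U
        · obtain ⟨δa, hδa, hba⟩ := Metric.isOpen_iff.1 (hU.preimage hvc) 0 h0
          exact ⟨δa, hδa, fun _ => hba⟩
        · exact ⟨1, one_pos, fun h => absurd h h0⟩
      set M : ℝ := ∑ z ∈ hfin.toFinset, ‖z‖ with hM
      have hMz : ∀ z ∈ Z, ‖z‖ ≤ M := fun z hz =>
        Finset.single_le_sum (f := fun z : ℂ => ‖z‖) (fun _ _ => norm_nonneg _) (hfin.mem_toFinset.2 hz)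
      have hM0 : 0 ≤ M := Finset.sum_nonneg fun _ _ => norm_nonneg _
      refine ⟨min δa (1 / (1 + M)), lt_min hδa (by positivity), fun h0 =>
        (ball_subset_ball (min_le_left _ _)).trans (hba h0), fun z hz => ?_⟩
      calc min δa (1 / (1 + M)) * ‖z‖ ≤ 1 / (1 + M) * M :=
            mul_le_mul (min_le_right _ _) (hMz z hz) (norm_nonneg _) (by positivity)
        _ < 1 := by rw [div_mul_eq_mul_div, one_mul, div_lt_one (by positivity)]; linarith
    obtain ⟨δ', hδ'pos, hδ'U, hδ'Z⟩ := hδi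
    -- the crossing data, indexed by `ι = Z ⊕ Zi`
    let ci : ↥Z ⊕ ↥Zi → Fin (1 + 1) := Sum.elim (fun _ => 0) (fun _ => 1)
    let zc : ↥Z ⊕ ↥Zi → ℂ := Sum.elim (fun z => (z : ℂ)) (fun w => (w : ℂ))
    let δc : ↥Z ⊕ ↥Zi → ℝ := Sum.elim (fun z => δ z) (fun _ => δ')
    have hδc : ∀ i, 0 < δc i := by
      rintro (z | w)
      · exact hδpos z
      · exact hδ'pos
    let Wset : ↥Z ⊕ ↥Zi → Set (ComplexProjectiveSpace 1) := fun i =>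
      (affineChart (ci i)).source ∩
        affineChart (ci i) ⁻¹' (ι.symm ⁻¹' ball (zc i) (δc i))
    have hWo : ∀ i, IsOpen (Wset i) := fun i =>
      (affineChart (ci i)).isOpen_inter_preimage (isOpen_ball.preimage ι.symm.continuous)
    have hWmem : ∀ i p, p ∈ Wset i ↔ CoordNeZero (ci i) p ∧ affineCoordComplex (ci i) p 0 ∈ ball (zc i) (δc i) := by
      intro i p
      simp only [Wset, mem_inter_iff, mem_preimage, affineChart_source, mem_setOf_eq, hι,
        ContinuousLinearEquiv.symm_apply_apply]
    let c' : ∀ i, OpenPartialHomeomorph (ComplexProjectiveSpace 1) (EuclideanSpace ℝ (Fin (2 * 1))) := fun i =>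
      (affineChart (ci i)).restrOpen (Wset i) (hWo i)
    let Uset : ↥Z ⊕ ↥Zi → Set (ComplexProjectiveSpace 1) := fun i => (c' i).source
    have hUmem : ∀ i p, p ∈ Uset i ↔ CoordNeZero (ci i) p ∧ affineCoordComplex (ci i) p 0 ∈ ball (zc i) (δc i) := by
      intro i p
      rw [← hWmem]
      change p ∈ (affineChart (ci i)).source ∩ Wset i ↔ _
      exact ⟨fun h => h.2, fun h => ⟨((hWmem i p).1 h).1, h⟩⟩
    have hrpt : ∀ i, ι (zc i) ∈ (c' i).target := by
      intro i
      refine ⟨mem_univ _, ?_⟩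
      change (affineChart (ci i)).symm (ι (zc i)) ∈ Wset i
      rw [hWmem]
      refine ⟨coordNeZero_affineChart_symm _ _, ?_⟩
      rw [affineCoordComplex_symm_iota ι hι]
      exact mem_ball_self (hδc i)
    let rpt : ∀ i, ↥(c' i).target := fun i => ⟨ι (zc i), hrpt i⟩
    let vpt : ↥Z ⊕ ↥Zi → ComplexProjectiveSpace 1 := fun i =>
      ((c' i).toHomeomorphSourceTarget.symm (rpt i) : ComplexProjectiveSpace 1)
    have hvU : ∀ i, vpt i ∈ Uset i := fun i => ((c' i).toHomeomorphSourceTarget.symm (rpt i)).2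
    have hvpt : ∀ i, vpt i = (affineChart (ci i)).symm (ι (zc i)) := fun i => rfl
    have hvcoord : ∀ i, CoordNeZero (ci i) (vpt i) ∧ affineCoordComplex (ci i) (vpt i) 0 = zc i := fun i =>
      ⟨coordNeZero_affineChart_symm _ _, affineCoordComplex_symm_iota ι hι _ _⟩
    -- values of `F` on the chart domains
    have hFU : ∀ i, ∀ t ∈ Uset i, F t = Sum.elim (fun _ => u (affineCoordComplex 0 t 0))
        (fun _ => v (affineCoordComplex 1 t 0)) i := by
      rintro (z | w) t ht
      · exact hF0 t ((hUmem _ t).1 ht).1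
      · exact hF1 t ((hUmem _ t).1 ht).1
    have hZi0 : ∀ w : ↥Zi, (w : ℂ) = 0 := fun w => w.2.1
    have hUN : ∀ i, ∀ t ∈ Uset i, F t ∈ U := by
      rintro (z | w) t ht
      · obtain ⟨h0, hb⟩ := (hUmem _ t).1 ht
        rw [hF0 t h0]
        exact hδU z hb
      · obtain ⟨h1, hb⟩ := (hUmem _ t).1 ht
        rw [hF1 t h1]
        have hv0 : v 0 ∈ U := by rw [← hZi0 w]; exact w.2.2.1
        have hb' : affineCoordComplex 1 t 0 ∈ ball (0 : ℂ) δ' := by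
          have := hb; rwa [show zc (Sum.inr w) = (w : ℂ) from rfl, hZi0 w] at this
        exact hδ'U hv0 hb'
    -- separation of the crossings
    have hinfty : ∀ w : ↥Zi, vpt (Sum.inr w) = (affineChart 1).symm (ι 0) := by
      intro w
      rw [hvpt, show zc (Sum.inr w) = (w : ℂ) from rfl, hZi0 w]
      rfl
    have hsep : ∀ i l, l ≠ i → vpt l ∉ Uset i := by
      rintro (z | w) (z' | w') hne hmem
      · -- two chart-`0` crossings
        obtain ⟨-, hb⟩ := (hUmem _ _).1 hmem
        have hc0 : affineCoordComplex 0 (vpt (Sum.inl z')) 0 = z' := (hvcoord (Sum.inl z')).2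
        have hb' : affineCoordComplex 0 (vpt (Sum.inl z')) 0 ∈ ball (z : ℂ) (δ z) := hb
        rw [hc0] at hb'
        exact hne (congrArg Sum.inl (Subtype.ext (hδsep z z' z'.2 hb')))
      · -- `∞` is not in the chart-`0` domain
        obtain ⟨h0, -⟩ := (hUmem _ _).1 hmem
        rw [hinfty] at h0
        exact not_coordNeZero_zero_infty ι hι h0
      · -- a chart-`0` crossing in the chart-`1` neighbourhood of `∞`: `‖1/z‖ < δ'`
        obtain ⟨h1, hb⟩ := (hUmem _ _).1 hmem
        have h0 : CoordNeZero 0 (vpt (Sum.inl z')) := (hvcoord (Sum.inl z')).1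
        have hinv := affineCoordComplex_one_eq_inv (vpt (Sum.inl z'))
        have hz0 := affineCoordComplex_zero_ne_zero h0 h1
        have hc0 : affineCoordComplex 0 (vpt (Sum.inl z')) 0 = z' := (hvcoord (Sum.inl z')).2
        have hb' : affineCoordComplex 1 (vpt (Sum.inl z')) 0 ∈ ball (w : ℂ) δ' := hb
        rw [hinv, hc0, hZi0 w, mem_ball_zero_iff, norm_inv] at hb'
        clear hb
        have hb := hb'
        have hlt := hδ'Z z' z'.2
        rw [hc0] at hz0
        have hzpos : 0 < ‖(z' : ℂ)‖ := norm_pos_iff.2 hz0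
        rw [inv_lt_iff_one_lt_mul₀ hzpos] at hb
        linarith [mul_comm δ' ‖(z' : ℂ)‖]
      · -- two chart-`1` crossings coincide
        exact hne (congrArg Sum.inr (Subtype.ext ((hZi0 w').trans (hZi0 w).symm)))
    have hvinj : Injective vpt := by
      intro i l h
      by_contra hne
      exact hsep i l (Ne.symm hne) (h ▸ hvU i)
    -- the crossing set
    have hF : {t | F t ∈ P} = ⋃ i ∈ (Finset.univ : Finset (↥Z ⊕ ↥Zi)), ({vpt i} : Set (ComplexProjectiveSpace 1)) := by
      ext t
      simp only [mem_setOf_eq, mem_iUnion, mem_singleton_iff, Finset.mem_univ, exists_true_left]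
      constructor
      · intro ht
        rcases coordNeZero_zero_or_eq_infty ι hι t with h0 | hinf
        · have hFt : F t = u (affineCoordComplex 0 t 0) := hF0 t h0
          have hzZ : affineCoordComplex 0 t 0 ∈ Z := by
            have := ht; rw [hFt] at this; exact this
          refine ⟨Sum.inl ⟨_, hzZ⟩, ?_⟩
          rw [hvpt]
          exact eq_symm_iota_of_coordNeZero ι hι h0
        · have h1 : CoordNeZero 1 t := by rw [hinf]; exact coordNeZero_affineChart_symm 1 _
          have hFt : F t = v 0 := by
            rw [hF1 t h1, hinf, affineCoordComplex_symm_iota ι hι]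
          have h0Z : (0 : ℂ) ∈ Zi := ⟨rfl, by have := ht; rw [hFt] at this; exact this⟩
          refine ⟨Sum.inr ⟨0, h0Z⟩, ?_⟩
          rw [hinfty, hinf]
      · rintro ⟨i, rfl⟩
        rcases i with z | w
        · show F (vpt (Sum.inl z)) ∈ P
          have hc0 : affineCoordComplex 0 (vpt (Sum.inl z)) 0 = z := (hvcoord (Sum.inl z)).2
          rw [hF0 _ (hvcoord (Sum.inl z)).1, hc0]
          exact z.2
        · show F (vpt (Sum.inr w)) ∈ P
          have hc1 : affineCoordComplex 1 (vpt (Sum.inr w)) 0 = w := (hvcoord (Sum.inr w)).2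
          rw [hF1 _ (hvcoord (Sum.inr w)).1, hc1]
          exact w.2.2
    -- the local pieces of `[ℂℙ¹]_{μ₀}` at the crossings and their local values
    let wpc : ∀ i, relativeSingularHomology ℤ ℤ ↥(Uset i) ({(⟨vpt i, hvU i⟩ : ↥(Uset i))}ᶜ) (2 * 1) := fun i =>
      localHomology.xEquiv ℤ ℤ (c' i).toHomeomorphSourceTarget.symm (rpt i) (2 * 1)
        ((localHomology.openSubsetIso ℤ ℤ (c' i).open_target (rpt i).2 (2 * 1)).inv (g.localClass (rpt i : (EuclideanSpace ℝ (Fin (2 * 1))))))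
    have hatlas : ∀ i, affineChart (ci i) ∈ atlas (EuclideanSpace ℝ (Fin (2 * 1))) (ComplexProjectiveSpace 1) := fun i =>
      (mem_atlas_iff _).2 ⟨ci i, rfl⟩
    have hσ : ∀ i, relativeSingularHomology.map ℤ ℤ (subsetIncl (Uset i))
        (localHomology.mapsTo_subsetIncl_compl (hvU i)) (2 * 1) (wpc i) =
        singularHomology.toLocal ℤ ℤ (vpt i) (2 * 1) μ₀.fundamentalClass := by
      intro i
      rw [HomologicalOrientation.isFundamentalClass_fundamentalClass_holds (2 * 1) μ₀ (vpt i)]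
      exact positiveAtlasOrientation_localClass_symm_restrOpen hXpos g (hatlas i) (hWo i) (rpt i)
    have hKφ : ∀ i, MapsTo (fun t : ↥(Uset i) => Kn ⟨F t, hUN i t t.2⟩)
        ({(⟨vpt i, hvU i⟩ : ↥(Uset i))}ᶜ : Set ↥(Uset i)) ({0}ᶜ : Set ℂ) := fun i =>
      hK.comp (mapsTo_crossingNhd F hUN hvU hsep hF i)
    -- a common small radius
    obtain ⟨r₀, hr₀, hr₀lt⟩ := exists_pos_lt_forall δc hδc
    refine ⟨r₀, hr₀, fun r hr hrr₀ => ?_⟩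
    have hρW : ∀ i, ι '' closedBall (ι.symm (rpt i)) r ⊆ (c' i).target := by
      intro i
      rintro _ ⟨ζ, hζ, rfl⟩
      refine ⟨mem_univ _, ?_⟩
      change (affineChart (ci i)).symm (ι ζ) ∈ Wset i
      rw [hWmem]
      refine ⟨coordNeZero_affineChart_symm _ _, ?_⟩
      rw [affineCoordComplex_symm_iota ι hι, mem_ball_iff_norm]
      have hζ' : ‖ζ - zc i‖ ≤ r := by
        have := mem_closedBall_iff_norm.1 hζ
        rwa [show (ι.symm (rpt i) : ℂ) = zc i from
          ι.symm_apply_apply (zc i)] at this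
      exact hζ'.trans_lt (hrr₀.trans_lt (hr₀lt i))
    let d : ↥Z ⊕ ↥Zi → ℤ := fun i =>
      wind (fun s => π (F ((affineChart (ci i)).symm (ι
        (circleLoop (ι.symm (rpt i)) r s)))))
    have hw : ∀ i, relativeSingularHomology.map ℤ ℤ
        (⟨fun t : ↥(Uset i) => Kn ⟨F t, hUN i t t.2⟩, by fun_prop⟩ : C(↥(Uset i), ℂ)) (hKφ i) (2 * 1)
        (wpc i) = d i • b₀ := fun i =>
      map_chartClass_eq_wind_smul g ι π hπc F (affineChart (ci i)) (hWo i) (hUN i) (rpt i) (hKφ i) hr (hρW i)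
    -- the sum formula
    have hz : exc (inv exc (singularHomology.toLocalOfSet ℤ ℤ X P (2 * 1)
        (singularHomology.map ℤ ℤ F (2 * 1) μ₀.fundamentalClass))) =
        singularHomology.toLocalOfSet ℤ ℤ X P (2 * 1) (singularHomology.map ℤ ℤ F (2 * 1) μ₀.fundamentalClass) := by
      rw [← ModuleCat.comp_apply, IsIso.inv_hom_id, ModuleCat.id_apply]
    have hB := map_eq_sum_smul_of_crossings hPc hU hPU Kn hK (2 * 1) F hUN hvinj hvU hsep hF
      μ₀.fundamentalClass wpc hσ hKφ b₀ d hw _ hz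
    have hsum1 : (∑ z : ↥Z, d (Sum.inl z)) = ∑ᶠ z ∈ Z, wind (fun t => π (u (circleLoop z r t))) := by
      rw [← finsum_set_coe_eq_finsum_mem, finsum_eq_sum_of_fintype]
      refine Finset.sum_congr rfl fun z _ => ?_
      change wind _ = wind _
      congr 1
      funext s
      show π (F ((affineChart 0).symm (ι
        (circleLoop (ι.symm (ι (z : ℂ))) r s)))) = π (u (circleLoop z r s))
      rw [ι.symm_apply_apply, hF0 _ (coordNeZero_affineChart_symm 0 _), affineCoordComplex_symm_iota ι hι]
    have hsum2 : (∑ w : ↥Zi, d (Sum.inr w)) = ∑ᶠ w ∈ Zi, wind (fun t => π (v (circleLoop w r t))) := by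
      rw [← finsum_set_coe_eq_finsum_mem, finsum_eq_sum_of_fintype]
      refine Finset.sum_congr rfl fun w _ => ?_
      change wind _ = wind _
      congr 1
      funext s
      show π (F ((affineChart 1).symm (ι
        (circleLoop (ι.symm (ι (w : ℂ))) r s)))) = π (v (circleLoop w r s))
      rw [ι.symm_apply_apply, hF1 _ (coordNeZero_affineChart_symm 1 _), affineCoordComplex_symm_iota ι hι]
    rw [hcΛ, hB, map_zsmul, heb, zsmul_eq_mul, mul_one, Fintype.sum_sum_type, hsum1, hsum2, Int.cast_id]
  -- the sign: `homologicalOrientationInt 1 = ± μ₀`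
  rcases HomologicalOrientation.eq_or_eq_neg_of_connected_holds (ComplexProjectiveSpace 1)
    (ComplexProjectiveSpace.homologicalOrientationInt 1) μ₀ with hμ | hμ
  · refine ⟨cΛ, fun u v F hu hv huv hF0 hF1 hfin => ?_⟩
    obtain ⟨r₀, hr₀, H⟩ := core u v F hu hv huv hF0 hF1 hfin
    refine ⟨r₀, hr₀, fun r hr hrr₀ => ?_⟩
    rw [hμ]
    exact H r hr hrr₀
  · refine ⟨-cΛ, fun u v F hu hv huv hF0 hF1 hfin => ?_⟩
    obtain ⟨r₀, hr₀, H⟩ := core u v F hu hv huv hF0 hF1 hfin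
    refine ⟨r₀, hr₀, fun r hr hrr₀ => ?_⟩
    rw [hμ, HomologicalOrientation.fundamentalClass_neg_holds ℤ (ComplexProjectiveSpace 1) (2 * 1) μ₀, map_neg,
      AddMonoidHom.neg_apply, map_neg, neg_neg]
    exact H r hr hrr₀

end SphereZeroSetIndex

end Literature.Geometry.Symplectic

end
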